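/-
COR-CM (cell pub-hodgecm2) — RSCONJ («`RecordSystem.conj`», IDENT-LEMMA component (e) «SPACE by construction»; coordinator 04:22Z,
PLANNER-A RSCONJ TABLE HOME∕INBOX l.14934; lead pen mukey-p6, RULINGS l.15162), row F2c «PIECES of the conjugate record system».
Pen prover-pub-hodgecm2-d2bridge-prove-5-g2-0 («b» mukey-p2).  Imports the RSCONJ FRAME (`HComp/RecordSystemConjFrame`, mukey-p6) and the
categorical half `HComp/RecordSystemConjCofan`.  KERNEL: theorems only (explicit binders, no `variable (h : …)`, no notation, no instance,
no named fact, no `sorry`).  HC_CM is NOT proved; HELD — WORLD = C FINAL; this file discharges no END binder and claims nothing about (iv-c).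
-/
import Literature.AlgebraicGeometry.ShimuraVarieties.UnitaryShimuraRecordDescent
import Literature.AlgebraicGeometry.ShimuraVarieties.UnitaryBallConjugateDatum
import Summits.HodgeConjecture.CorCM.D2Bridge.UnitaryGroupFinAdelicConj
import Summits.HodgeConjecture.CorCM.D2Bridge.BettiConjugateEmbedding
import Summits.HodgeConjecture.CorCM.B01.Transposition.HComp.RecordSystemConjFrame
import Summits.HodgeConjecture.CorCM.B01.Transposition.HComp.RecordSystemConjCofan
import HarnessLib

/-!
# RSCONJ (F2c): the pieces of the conjugate record system

For a Deligne record system `R : RecordSystem L H τ T hT K₀` (`UnitaryShimuraCanonicalModel`), a small level `K ≤ K₀`,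
the conjugate level `K' = (c ⊗ 1) K ≤ U(cH)(𝔸_{L⁺,f})`, ANY `L`-scheme `M'` with an isomorphism of `ℂ`-schemes
`Ψ : conjugateVariety conj ((M_K)_τ) ≅ (M')_τ` and ANY identification `pts' : M'(ℂ) ≃ₜ Sh_{K'}(U(cH), 𝔹²)(ℂ)` (frame
`T̄ = conjFrame T`) satisfying the POINT FORMULA (P∕PΨ of the RSCONJ chain)
`(pts')⁻¹ [x, a]_{cH} = Ψ (conj ((R.pts K)⁻¹ [x̄, (c ⊗ 1)⁻¹ a]_H))` on points of `(M')_τ`, the clause (F2c) `pieces`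
of `RecordSystem` holds for `(cH, τ, T̄, K', M', pts')`: `(M')_τ` is the cofan colimit of the COMPLEX-CONJUGATE ball
quotients `conj (X_q)` of the pieces of `(M_K)_τ` (tree ✔ `UnitaryBallUniformisationDatum.conjugate`: Gram matrix
`conj (H^τ) = (cH)^τ`, group `conj Γ_H(g_q K g_q⁻¹)^τ = Γ_{cH}((c⊗1)(g_q) K' (c⊗1)(g_q)⁻¹)^τ`, uniformisation
`v ↦ conj (unif v̄)`), re-indexed along `Ξ_K(H) ≃ Ξ_{K'}(cH)`, `[g] ↦ [(c ⊗ 1) g]`.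

Ingredients: base change of `ℂ`-schemes along `conj` is an equivalence (`Over.pullbackComp`, `Over.pullbackId`;
pattern of the tree's `AbelianVariety.baseChangeEquivOfInverse`), hence carries colimit cofans to colimit cofans
(Mathlib `isColimitCofanMkObjOfIsColimit`); re-indexing of cofans along an equivalence of index types
(`IsColimit.whiskerEquivalence`); naturality of `AlgPoints.toConjugate` in the `ℂ`-scheme; wb-10's
`arithmeticLevel_map_finAdelicConj` (`Γ((c ⊗ 1)K) = c Γ(K)`); the frame's `conjBall ∕ lift_conjBall ∕ conjFrame_mulVec_star ∕
groupConj ∕ rationalConj ∕ groupConj_rationalToFinAdelic`.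

References: [Deligne1979ShimuraVarieties] 2.1.2 (the pieces `Γ_g \ X⁺` indexed by `G(ℚ)\G(𝔸^f)/K`); [Milne2005ShimuraVarieties]
Lemma 5.13 and §12 (conjugates of Shimura varieties); [SerreGAGA1956] §2 (the conjugate complex structure); [PlatonovRapinchuk1994]
§5.1 (through wb-10's `UnitaryGroupFinAdelicConj`).
-/

set_option autoImplicit false

noncomputable section

open CategoryTheory AlgebraicGeometry NumberField IsDedekindDomain Matrix
open Literature.AlgebraicGeometry.Motives
open Literature.NumberTheory.Automorphic.Liu2021.AppendixC (C5.OpenCompactSubgroup C5.SmallLevel)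

universe u

namespace Summit.HodgeConjecture.CorCM.Model.RecordSystemConj


/-! ## (F2c) the PIECES of the conjugate record system (prove-5 g2; RSCONJ row R4b ∕ F2c) -/

section PiecesConj

open Limits
open Literature.AlgebraicGeometry.ShimuraVarieties Literature.AlgebraicGeometry.ShimuraVarieties.UnitaryCanonicalModel
open Literature.AlgebraicGeometry.Motives.AlgPoints (toConjugate)
open Literature.NumberTheory.Automorphic Literature.NumberTheory.Automorphic.UnitaryGroup
open Literature.NumberTheory.Automorphic.ShimuraDissection
open Literature.Geometry.ComplexHyperbolic Literature.Geometry.ComplexHyperbolic.BallModel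
open Summit.HodgeConjecture.CorCM.D2Bridge.UnitaryGroupConj
open MulAction

/-! ### (c) conjugate levels -/

/-- `conj ∘ τ = τ ∘ c` for a complex embedding `τ` of the CM field `L`. [folklore] -/
theorem starRingEnd_comp_eq_comp_complexConj (L : Type) [Field L] [NumberField L] [IsCMField L] (τ : L →+* ℂ) :
    (starRingEnd ℂ).comp τ = τ.comp ((IsCMField.complexConj L : L ≃ₐ[↥(maximalRealSubfield L)] L) : L →+* L) :=
  RingHom.ext fun x => by
    simp only [RingHom.coe_comp, Function.comp_apply, RingHom.coe_coe, IsCMField.complexEmbedding_complexConj]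

/-- `conj (H^τ) = (cH)^τ` entrywise. [folklore] -/
theorem map_map_starRingEnd_eq_conjGram_map (L : Type) [Field L] [NumberField L] [IsCMField L]
    (H : Matrix (Fin 3) (Fin 3) L) (τ : L →+* ℂ) :
    (H.map τ).map (starRingEnd ℂ) = (conjGram L H).map τ := by
  rw [Matrix.map_map, Matrix.map_map, ← RingHom.coe_comp, ← RingHom.coe_comp, starRingEnd_comp_eq_comp_complexConj]

/-- **The conjugate arithmetic level**: for `K' = (c ⊗ 1) K`,
`conj (Γ_H(g K g⁻¹)^τ) = Γ_{cH}((c⊗1)(g) K' (c⊗1)(g)⁻¹)^τ` in `GL₃(ℂ)` (wb-10 `arithmeticLevel_map_finAdelicConj` + `conj ∘ τ = τ ∘ c`).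
[cite: PlatonovRapinchuk1994, §5.1] -/
theorem arithmeticLevel_conj_map_eq (L : Type) [Field L] [NumberField L] [IsCMField L] (H : Matrix (Fin 3) (Fin 3) L)
    (τ : L →+* ℂ) (K : Subgroup ↥(finAdelic (↥(maximalRealSubfield L)) L (IsCMField.complexConj L) 3 H))
    (K' : Subgroup ↥(finAdelic (↥(maximalRealSubfield L)) L (IsCMField.complexConj L) 3 (conjGram L H)))
    (hK' : K.map (groupConj L H).toMonoidHom = K')
    (g : finAdelic (↥(maximalRealSubfield L)) L (IsCMField.complexConj L) 3 H) :
    ((arithmeticLevel (↥(maximalRealSubfield L)) L (IsCMField.complexConj L) 3 H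
        (K.map (MulAut.conj g).toMonoidHom)).map (Matrix.GeneralLinearGroup.map τ)).map
        (Matrix.GeneralLinearGroup.map (starRingEnd ℂ)) =
      (arithmeticLevel (↥(maximalRealSubfield L)) L (IsCMField.complexConj L) 3 (conjGram L H)
        (K'.map (MulAut.conj (groupConj L H g)).toMonoidHom)).map (Matrix.GeneralLinearGroup.map τ) := by
  subst hK'
  have hconj : (K.map (groupConj L H).toMonoidHom).map (MulAut.conj (groupConj L H g)).toMonoidHom =
      (K.map (MulAut.conj g).toMonoidHom).map (groupConj L H).toMonoidHom := by
    rw [Subgroup.map_map, Subgroup.map_map]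
    congr 1
    refine MonoidHom.ext fun k => ?_
    simp [MulAut.conj_apply, map_mul, map_inv]
    rfl
  rw [hconj, arithmeticLevel_map_finAdelicConj (↥(maximalRealSubfield L)) L (IsCMField.complexConj L) 3 rfl,
    Subgroup.map_map, Subgroup.map_map, ← Matrix.GeneralLinearGroup.map_comp, ← Matrix.GeneralLinearGroup.map_comp,
    starRingEnd_comp_eq_comp_complexConj]

/-! ### (d) the index bijection `Ξ_K(H) ≃ Ξ_{(c⊗1)K}(cH)` -/

/-- **`[g] ↦ [(c ⊗ 1) g]` is a bijection `U(H)(L⁺)\U(H)(𝔸_f)/K ≃ U(cH)(L⁺)\U(cH)(𝔸_f)/(c⊗1)K`** (`(c ⊗ 1)` is a group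
isomorphism carrying `K` to `(c⊗1)K` and the diagonal `U(H)(L⁺)` onto the diagonal `U(cH)(L⁺)`, frame
`groupConj_rationalToFinAdelic`). [cite: Milne2005ShimuraVarieties, Lemma 5.13] -/
theorem exists_indexConj (L : Type) [Field L] [NumberField L] [IsCMField L] (H : Matrix (Fin 3) (Fin 3) L)
    (K : Subgroup ↥(finAdelic (↥(maximalRealSubfield L)) L (IsCMField.complexConj L) 3 H))
    (K' : Subgroup ↥(finAdelic (↥(maximalRealSubfield L)) L (IsCMField.complexConj L) 3 (conjGram L H)))
    (hK' : K.map (groupConj L H).toMonoidHom = K') :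
    ∃ e : orbitRel.Quotient (rational (↥(maximalRealSubfield L)) L (IsCMField.complexConj L) 3 H)
          (CosetSpace (rationalToFinAdelic (↥(maximalRealSubfield L)) L (IsCMField.complexConj L) 3 H) K) ≃
        orbitRel.Quotient (rational (↥(maximalRealSubfield L)) L (IsCMField.complexConj L) 3 (conjGram L H))
          (CosetSpace (rationalToFinAdelic (↥(maximalRealSubfield L)) L (IsCMField.complexConj L) 3 (conjGram L H)) K'),
      ∀ ξ : finAdelic (↥(maximalRealSubfield L)) L (IsCMField.complexConj L) 3 H,
        e (Quotient.mk'' (CosetSpace.pt (rationalToFinAdelic _ L _ 3 H) K ξ)) =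
          Quotient.mk'' (CosetSpace.pt (rationalToFinAdelic _ L _ 3 (conjGram L H)) K' (groupConj L H ξ)) := by
  subst hK'
  -- the map on coset spaces `ξ K ↦ (c⊗1)(ξ) K'`
  let E : CosetSpace (rationalToFinAdelic (↥(maximalRealSubfield L)) L (IsCMField.complexConj L) 3 H) K ≃
      CosetSpace (rationalToFinAdelic (↥(maximalRealSubfield L)) L (IsCMField.complexConj L) 3 (conjGram L H))
        (K.map (groupConj L H).toMonoidHom) :=
    Quotient.congr (groupConj L H).toEquiv fun a b => by
      rw [QuotientGroup.leftRel_apply, QuotientGroup.leftRel_apply, Subgroup.mem_map_equiv]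
      change _ ↔ (groupConj L H).symm ((groupConj L H a)⁻¹ * groupConj L H b) ∈ K
      rw [← map_inv, ← map_mul, (groupConj L H).symm_apply_apply]
  have hE : ∀ ξ, E (CosetSpace.pt _ K ξ) = CosetSpace.pt _ (K.map (groupConj L H).toMonoidHom) (groupConj L H ξ) :=
    fun ξ => Quotient.congr_mk _ _ _
  -- equivariance along `γ ↦ c γ`
  have hEsmul : ∀ (γ : rational (↥(maximalRealSubfield L)) L (IsCMField.complexConj L) 3 H) (y : CosetSpace _ K),
      E (γ • y) = rationalConj L H γ • E y := by
    intro γ y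
    obtain ⟨ξ, rfl⟩ := CosetSpace.pt_surjective _ K y
    rw [CosetSpace.smul_pt, hE, hE, CosetSpace.smul_pt, map_mul, groupConj_rationalToFinAdelic]
  refine ⟨Quotient.congr E fun a b => ?_, fun ξ => ?_⟩
  · rw [orbitRel_apply, orbitRel_apply, mem_orbit_iff, mem_orbit_iff]
    constructor
    · rintro ⟨γ, rfl⟩
      exact ⟨rationalConj L H γ, (hEsmul γ b).symm⟩
    · rintro ⟨γ', h⟩
      refine ⟨(rationalConj L H).symm γ', E.injective ?_⟩
      rw [hEsmul, MulEquiv.apply_symm_apply, h]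
  · exact (Quotient.congr_mk _ _ _).trans (congrArg _ (hE ξ))

/-! ### (e) the pieces of the conjugate COMPLEX record system -/

/-- **(C2c) for the conjugate complex datum.**  Let `Sc` be a complex record system for `(H, τ, T)` below `K₀`
(`UnitaryCanonicalModel.ComplexRecordSystem`), `K ≤ K₀` a small level and `K' = (c ⊗ 1) K ≤ U(cH)(𝔸_{L⁺,f})`.  For ANY
`ℂ`-scheme `Mc'` with an isomorphism `Ψ : conj(Mc_K) ≅ Mc'` (`conj(·) = Motives.conjugateVariety conjAut`) and ANY identification
`pts' : Mc'(ℂ) ≃ₜ Sh_{K'}(U(cH), 𝔹²)(ℂ)` in the conjugate frame `T̄ = conjFrame T` satisfying the POINT FORMULA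
`(pts')⁻¹ [x, a] = Ψ (toConjugate ((Sc.pts K)⁻¹ [x̄, (c ⊗ 1)⁻¹ a]))` (the RSCONJ chain's (P_ℂ)), the clause `pieces` of
`ComplexRecordSystem` holds for `(cH, τ, T̄, K', Mc', pts')`: `Mc'` is the cofan colimit, indexed by `Ξ_{K'}(cH)` through the
representatives `(c ⊗ 1)(g_q)`, of the COMPLEX-CONJUGATE ball quotients `conj(X_q)` of the pieces of `Mc_K` (tree
`UnitaryBallUniformisationDatum.conjugate`: Gram matrix `conj(H^τ) = (cH)^τ`, natural level
`conj(Γ_H(g_q K g_q⁻¹)^τ) = Γ_{cH}((c⊗1)(g_q) K' (c⊗1)(g_q)⁻¹)^τ`, uniformisation `v ↦ conj(unif v̄)`), the cofan being transported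
along the equivalence `baseChangeHom conj` of `Sch/ℂ`, re-indexed along `Ξ_K(H) ≃ Ξ_{K'}(cH)` and moved to `Mc'` along `Ψ`.
[cite: Deligne1979ShimuraVarieties, 2.1.2] [cite: Milne2005ShimuraVarieties, Lemma 5.13 p. 57] [cite: SerreGAGA1956, §2] -/
theorem complexPieces_conj_of_pointFormula
    {L : Type} [Field L] [NumberField L] [IsCMField L] {H : Matrix (Fin 3) (Fin 3) L}
    {τ : L →+* ℂ} {T : GL (Fin 3) ℂ} {hT : formCongr (starRingEnd ℂ) T (H.map τ) = BallModel.J}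
    {K₀ : C5.OpenCompactSubgroup ↥(finAdelic (↥(maximalRealSubfield L)) L (IsCMField.complexConj L) 3 H)}
    (Sc : ComplexRecordSystem L H τ T hT K₀) (K : C5.SmallLevel K₀)
    (K' : Subgroup ↥(finAdelic (↥(maximalRealSubfield L)) L (IsCMField.complexConj L) 3 (conjGram L H)))
    (hK' : (K.1.1 : Subgroup ↥(finAdelic (↥(maximalRealSubfield L)) L (IsCMField.complexConj L) 3 H)).map
      (groupConj L H).toMonoidHom = K')
    (Mc' : SchemeOver ℂ) (Ψ : conjugateVariety conjAut (Sc.Mc.obj K) ≅ Mc')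
    (pts' : ComplexPoints Mc' ≃ₜ ShimuraSet L (conjGram L H) τ (conjFrame T) (formCongr_conjFrame L H τ T hT) K')
    (hP : ∀ (x : Ball) (a : finAdelic (↥(maximalRealSubfield L)) L (IsCMField.complexConj L) 3 (conjGram L H)),
        pts'.symm (ShimuraSet.mk L (conjGram L H) τ (conjFrame T) (formCongr_conjFrame L H τ T hT) K' x a) =
          AlgPoints.map Ψ.hom (toConjugate conjAut (Sc.Mc.obj K)
            ((Sc.pts K).symm (ShimuraSet.mk L H τ T hT K.1.1 (conjBall x) ((groupConj L H).symm a))))) :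
    ∃ (g : orbitRel.Quotient (rational (↥(maximalRealSubfield L)) L (IsCMField.complexConj L) 3 (conjGram L H))
          (CosetSpace (rationalToFinAdelic (↥(maximalRealSubfield L)) L (IsCMField.complexConj L) 3 (conjGram L H)) K') →
        finAdelic (↥(maximalRealSubfield L)) L (IsCMField.complexConj L) 3 (conjGram L H))
      (_ : ∀ q, Quotient.mk'' (CosetSpace.pt (rationalToFinAdelic _ L _ 3 (conjGram L H)) K' (g q)) = q)
      (X : orbitRel.Quotient (rational (↥(maximalRealSubfield L)) L (IsCMField.complexConj L) 3 (conjGram L H))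
          (CosetSpace (rationalToFinAdelic (↥(maximalRealSubfield L)) L (IsCMField.complexConj L) 3 (conjGram L H)) K') →
        SchemeOver ℂ)
      (ι : ∀ q, X q ⟶ Mc')
      (_ : IsColimit (Cofan.mk Mc' ι))
      (B : ∀ q, UnitaryBallUniformisationDatum 2 (X q)),
      ∀ q, (B q).Hℂ = (conjGram L H).map τ ∧
        (B q).Γ.map (Matrix.GeneralLinearGroup.map ((B q).τ₁ : ↥(B q).E →+* ℂ)) =
          (arithmeticLevel (↥(maximalRealSubfield L)) L (IsCMField.complexConj L) 3 (conjGram L H)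
            (K'.map (MulAut.conj (g q)).toMonoidHom)).map (Matrix.GeneralLinearGroup.map τ) ∧
        ∀ x : Ball, AlgPoints.map (ι q)
            ((B q).unif (((conjFrame T : GL (Fin 3) ℂ) : Matrix (Fin 3) (Fin 3) ℂ) *ᵥ BallModel.lift x)) =
          pts'.symm (ShimuraSet.mk L (conjGram L H) τ (conjFrame T) (formCongr_conjFrame L H τ T hT) K' x (g q)) := by
  obtain ⟨g, hg, X, ι, hcol, B, hB⟩ := Sc.pieces K
  obtain ⟨e, he⟩ := exists_indexConj L H K.1.1 K' hK'
  -- the transported cofan: base change along `conj`, re-indexed along `e`, moved to `Mc'` along `Ψ`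
  obtain ⟨h1⟩ := nonempty_isColimit_cofan_baseChangeHom_ringEquiv conjAut X ι hcol
  obtain ⟨h2⟩ := nonempty_isColimit_cofan_reindex e.symm h1
  have h3 : IsColimit (Cofan.mk Mc' (fun q' => (baseChangeHom conjAut.toRingHom).map (ι (e.symm q')) ≫ Ψ.hom) :
      Cofan fun q' => (baseChangeHom conjAut.toRingHom).obj (X (e.symm q'))) :=
    h2.ofIsoColimit (Cofan.ext Ψ fun _ => rfl)
  refine ⟨fun q' => groupConj L H (g (e.symm q')), fun q' => ?_,
    fun q' => (baseChangeHom conjAut.toRingHom).obj (X (e.symm q')),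
    fun q' => (baseChangeHom conjAut.toRingHom).map (ι (e.symm q')) ≫ Ψ.hom, h3,
    fun q' => (B (e.symm q')).conjugate, fun q' => ⟨?_, ?_, fun x => ?_⟩⟩
  · -- representatives
    beta_reduce
    rw [← he, hg, Equiv.apply_symm_apply]
  · -- the Gram matrix `conj (H^τ) = (cH)^τ`
    beta_reduce
    rw [UnitaryBallUniformisationDatum.conjugate_Hℂ_eq_map_conj, (hB (e.symm q')).1,
      map_map_starRingEnd_eq_conjGram_map]
  · -- the natural level
    beta_reduce
    rw [UnitaryBallUniformisationDatum.conjugate_Γ_map_τ₁, (hB (e.symm q')).2.1]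
    exact arithmeticLevel_conj_map_eq L H τ K.1.1 K' hK' (g (e.symm q'))
  · -- the uniformisation `z ↦ [z, (c⊗1)(g_q) K']`
    beta_reduce
    have hstar : star ((((conjFrame T : GL (Fin 3) ℂ) : Matrix (Fin 3) (Fin 3) ℂ) *ᵥ BallModel.lift x)) =
        (T : Matrix (Fin 3) (Fin 3) ℂ) *ᵥ BallModel.lift (conjBall x) := by
      have hx : BallModel.lift x = star (BallModel.lift (conjBall x)) := by
        rw [lift_conjBall, star_star]
      rw [hx, conjFrame_mulVec_star, star_star]
    rw [AlgPoints.map_comp_apply, UnitaryBallUniformisationDatum.conjugate_unif, hstar,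
      map_baseChangeHom_map_toConjugate, (hB (e.symm q')).2.2 (conjBall x), hP,
      (groupConj L H).symm_apply_apply]
    rfl

/-- **(C2c) for the conjugate complex datum on the nose** (`Ψ := 𝟙`): the pieces of `conj(Mc_K)` itself, for any identification
`pts'` of its complex points with `Sh_{K'}(U(cH), 𝔹²)(ℂ)` satisfying `(pts')⁻¹ [x, a] = toConjugate ((Sc.pts K)⁻¹ [x̄, (c⊗1)⁻¹ a])`
— the shape of the RSCONJ chain's `conjMc ∕ conjPts` at `K := (c ⊗ 1)⁻¹ K'`.
[cite: Deligne1979ShimuraVarieties, 2.1.2] [cite: Milne2005ShimuraVarieties, Lemma 5.13 p. 57] -/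
theorem complexPieces_conj_of_pointFormula_refl
    {L : Type} [Field L] [NumberField L] [IsCMField L] {H : Matrix (Fin 3) (Fin 3) L}
    {τ : L →+* ℂ} {T : GL (Fin 3) ℂ} {hT : formCongr (starRingEnd ℂ) T (H.map τ) = BallModel.J}
    {K₀ : C5.OpenCompactSubgroup ↥(finAdelic (↥(maximalRealSubfield L)) L (IsCMField.complexConj L) 3 H)}
    (Sc : ComplexRecordSystem L H τ T hT K₀) (K : C5.SmallLevel K₀)
    (K' : Subgroup ↥(finAdelic (↥(maximalRealSubfield L)) L (IsCMField.complexConj L) 3 (conjGram L H)))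
    (hK' : (K.1.1 : Subgroup ↥(finAdelic (↥(maximalRealSubfield L)) L (IsCMField.complexConj L) 3 H)).map
      (groupConj L H).toMonoidHom = K')
    (pts' : ComplexPoints (conjugateVariety conjAut (Sc.Mc.obj K)) ≃ₜ
      ShimuraSet L (conjGram L H) τ (conjFrame T) (formCongr_conjFrame L H τ T hT) K')
    (hP : ∀ (x : Ball) (a : finAdelic (↥(maximalRealSubfield L)) L (IsCMField.complexConj L) 3 (conjGram L H)),
        pts'.symm (ShimuraSet.mk L (conjGram L H) τ (conjFrame T) (formCongr_conjFrame L H τ T hT) K' x a) =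
          toConjugate conjAut (Sc.Mc.obj K)
            ((Sc.pts K).symm (ShimuraSet.mk L H τ T hT K.1.1 (conjBall x) ((groupConj L H).symm a)))) :
    ∃ (g : orbitRel.Quotient (rational (↥(maximalRealSubfield L)) L (IsCMField.complexConj L) 3 (conjGram L H))
          (CosetSpace (rationalToFinAdelic (↥(maximalRealSubfield L)) L (IsCMField.complexConj L) 3 (conjGram L H)) K') →
        finAdelic (↥(maximalRealSubfield L)) L (IsCMField.complexConj L) 3 (conjGram L H))
      (_ : ∀ q, Quotient.mk'' (CosetSpace.pt (rationalToFinAdelic _ L _ 3 (conjGram L H)) K' (g q)) = q)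
      (X : orbitRel.Quotient (rational (↥(maximalRealSubfield L)) L (IsCMField.complexConj L) 3 (conjGram L H))
          (CosetSpace (rationalToFinAdelic (↥(maximalRealSubfield L)) L (IsCMField.complexConj L) 3 (conjGram L H)) K') →
        SchemeOver ℂ)
      (ι : ∀ q, X q ⟶ conjugateVariety conjAut (Sc.Mc.obj K))
      (_ : IsColimit (Cofan.mk (conjugateVariety conjAut (Sc.Mc.obj K)) ι))
      (B : ∀ q, UnitaryBallUniformisationDatum 2 (X q)),
      ∀ q, (B q).Hℂ = (conjGram L H).map τ ∧
        (B q).Γ.map (Matrix.GeneralLinearGroup.map ((B q).τ₁ : ↥(B q).E →+* ℂ)) =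
          (arithmeticLevel (↥(maximalRealSubfield L)) L (IsCMField.complexConj L) 3 (conjGram L H)
            (K'.map (MulAut.conj (g q)).toMonoidHom)).map (Matrix.GeneralLinearGroup.map τ) ∧
        ∀ x : Ball, AlgPoints.map (ι q)
            ((B q).unif (((conjFrame T : GL (Fin 3) ℂ) : Matrix (Fin 3) (Fin 3) ℂ) *ᵥ BallModel.lift x)) =
          pts'.symm (ShimuraSet.mk L (conjGram L H) τ (conjFrame T) (formCongr_conjFrame L H τ T hT) K' x (g q)) :=
  complexPieces_conj_of_pointFormula Sc K K' hK' _ (Iso.refl _) pts' fun x a => by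
    rw [hP x a, Iso.refl_hom, AlgPoints.map_id_apply]

/-! ### (f) the pieces of the conjugate record system, `L`-side reading (`RecordSystem.pieces` shape) -/

/-- **(F2c) for the conjugate datum, `L`-side.**  Let `R` be a record system for `(H, τ, T)` below `K₀`, `K ≤ K₀` a small level and
`K' = (c ⊗ 1) K`.  For ANY `L`-scheme `M'`, ANY isomorphism of `ℂ`-schemes `Ψ : conj((M_K)_τ) ≅ (M')_τ` and ANY identification
`pts' : M'(ℂ) ≃ₜ Sh_{K'}(U(cH), 𝔹²)(ℂ)` in the frame `T̄` satisfying `((pts')⁻¹ [x, a])_τ = Ψ (toConjugate (((R.pts K)⁻¹ [x̄, (c⊗1)⁻¹ a])_τ))`,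
the clause `RecordSystem.pieces` holds for `(cH, τ, T̄, K', M', pts')` — the complex statement `complexPieces_conj_of_pointFormula`
for the complex shadow `R.complexRecordSystem` (`Mc_K = (M_K)_τ`, points moved by `AlgPoints.baseChangeEquiv τ`).
[cite: Deligne1979ShimuraVarieties, 2.1.2 and 2.2.5] [cite: Milne2005ShimuraVarieties, Lemma 5.13 p. 57] -/
theorem pieces_conj_of_pointFormula
    {L : Type} [Field L] [NumberField L] [IsCMField L] {H : Matrix (Fin 3) (Fin 3) L}
    {τ : L →+* ℂ} {T : GL (Fin 3) ℂ} {hT : formCongr (starRingEnd ℂ) T (H.map τ) = BallModel.J}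
    {K₀ : C5.OpenCompactSubgroup ↥(finAdelic (↥(maximalRealSubfield L)) L (IsCMField.complexConj L) 3 H)}
    (R : RecordSystem L H τ T hT K₀) (K : C5.SmallLevel K₀)
    (K' : Subgroup ↥(finAdelic (↥(maximalRealSubfield L)) L (IsCMField.complexConj L) 3 (conjGram L H)))
    (hK' : (K.1.1 : Subgroup ↥(finAdelic (↥(maximalRealSubfield L)) L (IsCMField.complexConj L) 3 H)).map
      (groupConj L H).toMonoidHom = K')
    (M' : SchemeOver L)
    (Ψ : conjugateVariety conjAut ((baseChangeHom τ).obj (R.M.obj K)) ≅ (baseChangeHom τ).obj M')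
    (pts' : letI : Algebra L ℂ := τ.toAlgebra
      ComplexPoints M' ≃ₜ ShimuraSet L (conjGram L H) τ (conjFrame T) (formCongr_conjFrame L H τ T hT) K')
    (hP : letI : Algebra L ℂ := τ.toAlgebra
      ∀ (x : Ball) (a : finAdelic (↥(maximalRealSubfield L)) L (IsCMField.complexConj L) 3 (conjGram L H)),
        AlgPoints.baseChangeEquiv τ M'
            (pts'.symm (ShimuraSet.mk L (conjGram L H) τ (conjFrame T) (formCongr_conjFrame L H τ T hT) K' x a)) =
          AlgPoints.map Ψ.hom (toConjugate conjAut ((baseChangeHom τ).obj (R.M.obj K))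
            (AlgPoints.baseChangeEquiv τ (R.M.obj K)
              ((R.pts K).symm (ShimuraSet.mk L H τ T hT K.1.1 (conjBall x) ((groupConj L H).symm a)))))) :
    letI : Algebra L ℂ := τ.toAlgebra
    ∃ (g : orbitRel.Quotient (rational (↥(maximalRealSubfield L)) L (IsCMField.complexConj L) 3 (conjGram L H))
          (CosetSpace (rationalToFinAdelic (↥(maximalRealSubfield L)) L (IsCMField.complexConj L) 3 (conjGram L H)) K') →
        finAdelic (↥(maximalRealSubfield L)) L (IsCMField.complexConj L) 3 (conjGram L H))
      (_ : ∀ q, Quotient.mk'' (CosetSpace.pt (rationalToFinAdelic _ L _ 3 (conjGram L H)) K' (g q)) = q)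
      (X : orbitRel.Quotient (rational (↥(maximalRealSubfield L)) L (IsCMField.complexConj L) 3 (conjGram L H))
          (CosetSpace (rationalToFinAdelic (↥(maximalRealSubfield L)) L (IsCMField.complexConj L) 3 (conjGram L H)) K') →
        SchemeOver ℂ)
      (ι : ∀ q, X q ⟶ (baseChangeHom τ).obj M')
      (_ : IsColimit (Cofan.mk ((baseChangeHom τ).obj M') ι))
      (B : ∀ q, UnitaryBallUniformisationDatum 2 (X q)),
      ∀ q, (B q).Hℂ = (conjGram L H).map τ ∧
        (B q).Γ.map (Matrix.GeneralLinearGroup.map ((B q).τ₁ : ↥(B q).E →+* ℂ)) =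
          (arithmeticLevel (↥(maximalRealSubfield L)) L (IsCMField.complexConj L) 3 (conjGram L H)
            (K'.map (MulAut.conj (g q)).toMonoidHom)).map (Matrix.GeneralLinearGroup.map τ) ∧
        ∀ x : Ball, AlgPoints.map (ι q)
            ((B q).unif (((conjFrame T : GL (Fin 3) ℂ) : Matrix (Fin 3) (Fin 3) ℂ) *ᵥ BallModel.lift x)) =
          AlgPoints.baseChangeEquiv τ M'
            (pts'.symm (ShimuraSet.mk L (conjGram L H) τ (conjFrame T) (formCongr_conjFrame L H τ T hT) K' x (g q))) := by
  letI : Algebra L ℂ := τ.toAlgebra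
  let b : ComplexPoints M' ≃ₜ ComplexPoints ((baseChangeHom τ).obj M') :=
    Homeomorph.mk (AlgPoints.baseChangeEquiv τ M') (AlgPoints.continuous_baseChangeEquiv τ M')
      (AlgPoints.continuous_baseChangeEquiv_symm τ M')
  exact complexPieces_conj_of_pointFormula R.complexRecordSystem K K' hK' ((baseChangeHom τ).obj M') Ψ
    (b.symm.trans pts') hP

end PiecesConj

end Summit.HodgeConjecture.CorCM.Model.RecordSystemConj

end
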